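import Summits.NavierStokesRegularity.FunctionalMining.StretchingLowerShear
import Summits.NavierStokesRegularity.FunctionalMining.StretchingLowerCellularIntegrals
import HarnessLib

/-!
# K1-Q1 lower side in the kernel: sheared-wave fields (part 2: the integrals, the kills, `2√3/9 ≤ C⋆`)

Cell `pub-nsfunc` (host summit NavierStokesRegularity, topic `FunctionalMining`), prove seat gen 4, on the
bank seat's `pub-nsfunc-bank/K1Q1-PRESSURELESS.md`. **Search for candidate a priori estimates; no regularity
claim.** Static field facts only; nothing is asserted about Navier–Stokes.

For the composition field `u = (0, −c g(x₀), T(x₁ + g(x₀)))` of part 1 (`ShearComposition.u g T c`), with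
`γ = ∫₀¹ g'²`, `τ = ∫₀¹ T'²`:
* `enstrophyProduction_u : ∫⟪(u·∇)u, Δu⟫ = c γ τ` and `torusEnstrophy_u : ℰ(u) = (τ(1+γ) + c²γ)/2`
  (planar lift `∫_{T³} = ∫_{T²}`, the volume-preserving shear `y ↦ y + g(y₀)e₁`, Fubini on `T² = T × T`,
  and the periodic integrations by parts `∫₀¹ T'T'' = 0`, `∫₀¹ g g'' = −γ`);
* **`not_stretchingSupBound_shear`**: if `|g'| ≤ G`, `|T'| ≤ Θ`, `c > 0`, `γ, τ > 0` then
  `StretchingSupBound C` fails for every `C < 2cγτ / (√(c²G² + (1+G²)Θ²)·(τ(1+γ) + c²γ))`;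
* along the tree's smoothed sawtooth profiles `S_ε` (`DEIJ.stageProfile ε _ _ 1 1 0`: `S_ε' = w_ε`,
  `|w_ε| ≤ 1`, `∫₀¹(1 − w_ε²) ≤ 4ε`), with `g = T = S_ε`, `c = 1`: `¬ StretchingSupBound C` for
  `C < 2(1−4ε)/(√3(3−4ε))`, whence **`two_sqrt_three_div_nine_le_stretchingSupConst : 2√3/9 ≤ C⋆`**
  (`ε → 0`). `2√3/9` is the bank's pressureless composition CLASS constant: `C_pl = 2√3/9` exactly
  (`StretchingClassConstShear.lean`); it is NOT the K1-Q1 window, whose tree record lower bound is larger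
  (`WrapFinal.nested_le_stretchingSupConst : (2+√5)/8 ≤ C⋆`, and the laminate rungs). Referee F29.2.
-/

noncomputable section

open MeasureTheory Set Filter Topology Function UnitAddTorus intervalIntegral
open scoped InnerProductSpace ContDiff

namespace Summit.NavierStokesRegularity.FunctionalMining

open Literature.Analysis Literature.Analysis.FunctionSpaces Literature.Analysis.FunctionSpaces.Torus
open Literature.Analysis.FluidPDE Literature.Analysis.FluidPDE.Torus

namespace ShearComposition

variable (g T : ShearProfile) (c : ℝ)

/-! ## 5. Mean square slopes and periodic integrations by parts
(Fubini on `T² = T × T` and the period integrals are `CellularStretching.integral_mul_coord`,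
`integral_circle_eq_intervalIntegral`, `integral_circle_const_one` of the cellular files.) -/

/-- `γ(φ) = ∫₀¹ φ'²`, the mean square slope of a profile. [ours; bookkeeping] -/
def msq (P : ShearProfile) : ℝ := ∫ t in (0 : ℝ)..1, deriv P t ^ 2

/-- `0 ≤ ∫₀¹ φ'²`. [folklore] -/
theorem msq_nonneg (P : ShearProfile) : 0 ≤ msq P :=
  intervalIntegral.integral_nonneg zero_le_one fun _ _ => sq_nonneg _

/-- Smooth profiles: `φ'` has derivative `φ''` everywhere. [folklore] -/
theorem hasDerivAt_deriv (P : ShearProfile) (t : ℝ) : HasDerivAt (deriv P) (deriv (deriv P) t) t :=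
  ((P.D.contDiff.differentiable (by simp)) t).hasDerivAt

/-- **`∫₀¹ T'·T'' = 0`** (periodicity of `T'`). [folklore] -/
theorem intervalIntegral_deriv_mul_deriv_deriv (P : ShearProfile) :
    ∫ t in (0 : ℝ)..1, deriv P t * deriv (deriv P) t = 0 := by
  have hc2 : Continuous (deriv (deriv P)) := P.D.D.contDiff.continuous
  have h := intervalIntegral.integral_mul_deriv_eq_deriv_mul (a := 0) (b := 1)
    (fun t _ => hasDerivAt_deriv P t) (fun t _ => hasDerivAt_deriv P t)
    (hc2.intervalIntegrable 0 1) (hc2.intervalIntegrable 0 1)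
  have hper : deriv P 1 = deriv P 0 := by have := P.D.periodic 0; simpa using this
  have hcomm : ∫ t in (0 : ℝ)..1, deriv (deriv P) t * deriv P t = ∫ t in (0 : ℝ)..1, deriv P t * deriv (deriv P) t :=
    intervalIntegral.integral_congr fun t _ => mul_comm _ _
  rw [hper, hcomm] at h
  linarith

/-- **`∫₀¹ g·g'' = −∫₀¹ g'²`** (integration by parts on a period). [folklore] -/
theorem intervalIntegral_mul_deriv_deriv (P : ShearProfile) :
    ∫ t in (0 : ℝ)..1, P t * deriv (deriv P) t = -msq P := by
  have hc1 : Continuous (deriv P) := P.D.contDiff.continuous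
  have hc2 : Continuous (deriv (deriv P)) := P.D.D.contDiff.continuous
  have h := intervalIntegral.integral_mul_deriv_eq_deriv_mul (a := 0) (b := 1)
    (fun t _ => ((P.contDiff.differentiable (by simp)) t).hasDerivAt) (fun t _ => hasDerivAt_deriv P t)
    (hc1.intervalIntegrable 0 1) (hc2.intervalIntegrable 0 1)
  have hper : deriv P 1 = deriv P 0 := by have := P.D.periodic 0; simpa using this
  have hper' : P 1 = P 0 := by have := P.periodic 0; simpa using this
  rw [hper, hper'] at h
  rw [h, msq]
  simp only [sub_self, zero_sub, pow_two]

/-! ## 6. Production `cγτ` and enstrophy `(τ(1+γ) + c²γ)/2` -/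

/-- The production integrand, unsheared: `F₁(y) = −c g(y₀)T'(y₁)·(g''(y₀)T'(y₁) + (1+g'(y₀)²)T''(y₁))`.
[ours; bookkeeping] -/
def F₁ (y : UnitAddTorus (Fin 2)) : ℝ :=
  (-c * g.onCircle (y 0) * T.D.onCircle (y 1)) *
    (g.D.D.onCircle (y 0) * T.D.onCircle (y 1) + (1 + g.D.onCircle (y 0) ^ 2) * T.D.D.onCircle (y 1))

/-- `F₁` is continuous. [folklore] -/
theorem continuous_F₁ : Continuous (F₁ g T c) := by
  unfold F₁
  have h0 := CellularStretching.continuous_onCircle_coord g 0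
  have h1 := CellularStretching.continuous_onCircle_coord T.D 1
  have h2 := CellularStretching.continuous_onCircle_coord g.D.D 0
  have h3 := CellularStretching.continuous_onCircle_coord g.D 0
  have h4 := CellularStretching.continuous_onCircle_coord T.D.D 1
  exact ((continuous_const.mul h0).mul h1).mul ((h2.mul h1).add ((continuous_const.add (h3.pow 2)).mul h4))

/-- The production integrand is `F₁ ∘ Φ ∘ π`. [ours; bookkeeping] -/
theorem inner_convect_laplacian_u_eq (x : UnitAddTorus (Fin 3)) :
    ⟪Torus.convect (u g T c) (u g T c) x, Torus.laplacian (u g T c) x⟫_ℝ = F₁ g T c (Φ g (planarProj x)) := by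
  rw [inner_convect_laplacian_u, F₁, Φ_apply_zero]
  rfl

/-- `∫_{T²} F₁ = cγτ`. [ours; elementary] -/
theorem integral_F₁ : ∫ y, F₁ g T c y = c * msq g * msq T := by
  have hsplit : ∀ y : UnitAddTorus (Fin 2), F₁ g T c y =
      (fun b => -c * (g.onCircle b * g.D.D.onCircle b)) (y 0) * (fun b => T.D.onCircle b ^ 2) (y 1) +
      (fun b => -c * (g.onCircle b * (1 + g.D.onCircle b ^ 2))) (y 0) *
        (fun b => T.D.onCircle b * T.D.D.onCircle b) (y 1) := by
    intro y; simp only [F₁]; ring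
  have hi1 : Integrable (fun y : UnitAddTorus (Fin 2) => (fun b => -c * (g.onCircle b * g.D.D.onCircle b)) (y 0) *
      (fun b => T.D.onCircle b ^ 2) (y 1)) volume :=
    Continuous.integrable_unitAddTorus ((continuous_const.mul ((CellularStretching.continuous_onCircle_coord g 0).mul
      (CellularStretching.continuous_onCircle_coord g.D.D 0))).mul ((CellularStretching.continuous_onCircle_coord T.D 1).pow 2))
  have hi2 : Integrable (fun y : UnitAddTorus (Fin 2) => (fun b => -c * (g.onCircle b * (1 + g.D.onCircle b ^ 2))) (y 0) *
      (fun b => T.D.onCircle b * T.D.D.onCircle b) (y 1)) volume :=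
    Continuous.integrable_unitAddTorus ((continuous_const.mul ((CellularStretching.continuous_onCircle_coord g 0).mul
      (continuous_const.add ((CellularStretching.continuous_onCircle_coord g.D 0).pow 2)))).mul
      ((CellularStretching.continuous_onCircle_coord T.D 1).mul (CellularStretching.continuous_onCircle_coord T.D.D 1)))
  simp_rw [hsplit]
  rw [integral_add hi1 hi2,
    CellularStretching.integral_mul_coord (fun b => -c * (g.onCircle b * g.D.D.onCircle b)) (fun b => T.D.onCircle b ^ 2),
    CellularStretching.integral_mul_coord (fun b => -c * (g.onCircle b * (1 + g.D.onCircle b ^ 2)))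
      (fun b => T.D.onCircle b * T.D.D.onCircle b),
    CellularStretching.integral_circle_eq_intervalIntegral, CellularStretching.integral_circle_eq_intervalIntegral, CellularStretching.integral_circle_eq_intervalIntegral, CellularStretching.integral_circle_eq_intervalIntegral]
  simp only [D_onCircle_coe]
  simp only [ShearProfile.coe_D, ShearProfile.onCircle_coe]
  have hTT : ∫ t in (0 : ℝ)..1, deriv T t * deriv (deriv T) t = 0 := intervalIntegral_deriv_mul_deriv_deriv T
  have hgg : ∫ t in (0 : ℝ)..1, -c * (g t * deriv (deriv g) t) = c * msq g := by
    rw [intervalIntegral.integral_const_mul, intervalIntegral_mul_deriv_deriv]; ring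
  rw [hgg, hTT, mul_zero, add_zero]
  rfl

/-- **The production of the composition field is `c γ τ`.** [ours] -/
theorem enstrophyProduction_u : enstrophyProduction (u g T c) = c * msq g * msq T := by
  unfold enstrophyProduction
  simp_rw [inner_convect_laplacian_u_eq]
  change ∫ x : UnitAddTorus (Fin 3), (F₁ g T c ∘ shearMap 1 0 g.neg) (planarProj x) = _
  rw [integral_comp_planarProj (((continuous_F₁ g T c).comp (continuous_shearMap 1 0 g.neg)).aestronglyMeasurable)]
  change ∫ y, F₁ g T c (shearMap 1 0 g.neg y) = _
  rw [DEIJ.integral_comp_shearMap' (by decide) g.neg (F₁ g T c), integral_F₁]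

/-- The gradient-square integrand, unsheared: `F₂(y) = c²g'(y₀)² + (1+g'(y₀)²)T'(y₁)²`. [ours; bookkeeping] -/
def F₂ (y : UnitAddTorus (Fin 2)) : ℝ := c ^ 2 * g.D.onCircle (y 0) ^ 2 + (1 + g.D.onCircle (y 0) ^ 2) * T.D.onCircle (y 1) ^ 2

/-- `F₂` is continuous. [folklore] -/
theorem continuous_F₂ : Continuous (F₂ g T c) := by
  unfold F₂
  have h3 := CellularStretching.continuous_onCircle_coord g.D 0
  have h1 := CellularStretching.continuous_onCircle_coord T.D 1
  exact (continuous_const.mul (h3.pow 2)).add ((continuous_const.add (h3.pow 2)).mul (h1.pow 2))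

/-- `∑ᵢ‖∂ᵢu(x)‖² = F₂(Φ(πx))`. [ours; bookkeeping] -/
theorem sum_norm_sq_partialDeriv_u_eq (x : UnitAddTorus (Fin 3)) :
    ∑ i, ‖Torus.partialDeriv i (u g T c) x‖ ^ 2 = F₂ g T c (Φ g (planarProj x)) := by
  rw [sum_norm_sq_partialDeriv_u, F₂, Φ_apply_zero]
  rfl

/-- `∫_{T²} F₂ = c²γ + (1+γ)τ`. [ours; elementary] -/
theorem integral_F₂ : ∫ y, F₂ g T c y = c ^ 2 * msq g + (1 + msq g) * msq T := by
  have hsplit : ∀ y : UnitAddTorus (Fin 2), F₂ g T c y =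
      (fun b => c ^ 2 * g.D.onCircle b ^ 2) (y 0) * (fun _ => (1 : ℝ)) (y 1) +
      (fun b => 1 + g.D.onCircle b ^ 2) (y 0) * (fun b => T.D.onCircle b ^ 2) (y 1) := by
    intro y; simp only [F₂]; ring
  have hi1 : Integrable (fun y : UnitAddTorus (Fin 2) => (fun b => c ^ 2 * g.D.onCircle b ^ 2) (y 0) *
      (fun _ => (1 : ℝ)) (y 1)) volume :=
    Continuous.integrable_unitAddTorus ((continuous_const.mul ((CellularStretching.continuous_onCircle_coord g.D 0).pow 2)).mul
      continuous_const)
  have hi2 : Integrable (fun y : UnitAddTorus (Fin 2) => (fun b => 1 + g.D.onCircle b ^ 2) (y 0) *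
      (fun b => T.D.onCircle b ^ 2) (y 1)) volume :=
    Continuous.integrable_unitAddTorus ((continuous_const.add ((CellularStretching.continuous_onCircle_coord g.D 0).pow 2)).mul
      ((CellularStretching.continuous_onCircle_coord T.D 1).pow 2))
  simp_rw [hsplit]
  rw [integral_add hi1 hi2,
    CellularStretching.integral_mul_coord (fun b => c ^ 2 * g.D.onCircle b ^ 2) (fun _ => (1 : ℝ)),
    CellularStretching.integral_mul_coord (fun b => 1 + g.D.onCircle b ^ 2) (fun b => T.D.onCircle b ^ 2),
    CellularStretching.integral_circle_const_one, CellularStretching.integral_circle_eq_intervalIntegral, CellularStretching.integral_circle_eq_intervalIntegral, CellularStretching.integral_circle_eq_intervalIntegral]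
  simp only [D_onCircle_coe]
  have hc1 : Continuous (deriv g) := g.D.contDiff.continuous
  have hi : IntervalIntegrable (fun t => deriv g t ^ 2) volume 0 1 := (hc1.pow 2).intervalIntegrable 0 1
  rw [intervalIntegral.integral_const_mul, intervalIntegral.integral_add intervalIntegrable_const hi,
    intervalIntegral.integral_const]
  simp [msq]

/-- **The enstrophy of the composition field is `(τ(1+γ) + c²γ)/2`.** [ours] -/
theorem torusEnstrophy_u : torusEnstrophy (u g T c) = (msq T * (1 + msq g) + c ^ 2 * msq g) / 2 := by
  rw [torusEnstrophy, Torus.gradNormSq]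
  simp_rw [sum_norm_sq_partialDeriv_u_eq]
  change 2⁻¹ * ∫ x : UnitAddTorus (Fin 3), (F₂ g T c ∘ shearMap 1 0 g.neg) (planarProj x) = _
  rw [integral_comp_planarProj (((continuous_F₂ g T c).comp (continuous_shearMap 1 0 g.neg)).aestronglyMeasurable)]
  change 2⁻¹ * ∫ y, F₂ g T c (shearMap 1 0 g.neg y) = _
  rw [DEIJ.integral_comp_shearMap' (by decide) g.neg (F₂ g T c), integral_F₂]
  ring

/-! ## 7. The kills along composition fields -/

/-- A profile with positive mean-square slope and `|φ'| ≤ G` has `0 < G`. [folklore] -/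
theorem pos_of_msq_pos {P : ShearProfile} {G : ℝ} (hG : ∀ t, |deriv P t| ≤ G) (h : 0 < msq P) : 0 < G := by
  by_contra hle
  have h0 : ∀ t, deriv P t = 0 := fun t => abs_nonpos_iff.1 ((hG t).trans (not_lt.1 hle))
  have : msq P = 0 := by simp [msq, h0]
  exact h.ne' this

/-- **K1-Q1 kernel kills along composition fields.** If `|g'| ≤ G`, `|T'| ≤ Θ`, `c > 0` and
`γ = ∫₀¹g'², τ = ∫₀¹T'²` are positive, then `StretchingSupBound C` fails for every
`C < 2cγτ / (√(c²G² + (1+G²)Θ²)·(τ(1+γ) + c²γ))` (the field `u = (0, −c g(x₀), T(x₁+g(x₀)))`: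
production `cγτ`, enstrophy `(τ(1+γ)+c²γ)/2`, `‖ω‖_∞² ≤ c²G² + (1+G²)Θ²`). Search for candidate a
priori estimates; no regularity claim. [ours] -/
theorem not_stretchingSupBound_shear {G Θ : ℝ} (hG : ∀ t, |deriv g t| ≤ G) (hΘ : ∀ t, |deriv T t| ≤ Θ)
    (hc : 0 < c) (hγ : 0 < msq g) (hτ : 0 < msq T) {C : ℝ}
    (hC : C < 2 * c * msq g * msq T /
      (Real.sqrt (c ^ 2 * G ^ 2 + (1 + G ^ 2) * Θ ^ 2) * (msq T * (1 + msq g) + c ^ 2 * msq g))) :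
    ¬ StretchingSupBound (d := Fin 3) C := by
  intro h
  have hGpos : 0 < G := pos_of_msq_pos hG hγ
  have hQ : 0 < c ^ 2 * G ^ 2 + (1 + G ^ 2) * Θ ^ 2 := by positivity
  obtain ⟨M, hM⟩ : ∃ M, M = Real.sqrt (c ^ 2 * G ^ 2 + (1 + G ^ 2) * Θ ^ 2) := ⟨_, rfl⟩
  have hM0 : 0 < M := by rw [hM]; exact Real.sqrt_pos.2 hQ
  have hM2 : M ^ 2 = c ^ 2 * G ^ 2 + (1 + G ^ 2) * Θ ^ 2 := by rw [hM, Real.sq_sqrt hQ.le]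
  have hω : ∀ x, torusVorticitySqAt (u g T c) x ≤ M ^ 2 := fun x => by
    rw [hM2]; exact torusVorticitySqAt_u_le g T c hG hΘ x
  have hle := h (Fintype.card_fin 3) (u g T c) (isSmooth_u g T c) (isDivFree_u g T c) M hM0.le hω
  rw [enstrophyProduction_u, torusEnstrophy_u] at hle
  rw [← hM] at hC
  have hD : 0 < M * (msq T * (1 + msq g) + c ^ 2 * msq g) := by positivity
  have hrC : 2 * c * msq g * msq T / (M * (msq T * (1 + msq g) + c ^ 2 * msq g)) ≤ C := by
    rw [div_le_iff₀ hD]; nlinarith [hle]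
  linarith

/-! ## 8. The smoothed-sawtooth ladder and `2√3/9 ≤ C⋆` -/

/-- The tree's smoothed triangle wave `S_ε` (`DEIJ.stageProfile`, amplitude `1`, frequency `1`, phase `0`):
`S_ε' = w_ε` with `|w_ε| ≤ 1` and `∫₀¹ (1 − w_ε²) ≤ 4ε`. [ours; bookkeeping] -/
def saw (ε : ℝ) (hε : 0 < ε) (hε' : ε ≤ 1 / 16) : ShearProfile := DEIJ.stageProfile ε hε hε' 1 1 0

/-- `S_ε' = w_ε`. [folklore] -/
theorem deriv_saw {ε : ℝ} (hε : 0 < ε) (hε' : ε ≤ 1 / 16) : deriv (saw ε hε hε') = DEIJ.slopeWave ε := by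
  rw [saw, DEIJ.deriv_stageProfile]; funext y; simp

/-- `|S_ε'| ≤ 1`. [folklore] -/
theorem abs_deriv_saw_le {ε : ℝ} (hε : 0 < ε) (hε' : ε ≤ 1 / 16) (t : ℝ) : |deriv (saw ε hε hε') t| ≤ 1 := by
  rw [deriv_saw]; exact DEIJ.abs_slopeWave_le hε hε' t

/-- **`1 − 4ε ≤ ∫₀¹ S_ε'² ≤ 1`.** [folklore] -/
theorem msq_saw_bounds {ε : ℝ} (hε : 0 < ε) (hε' : ε ≤ 1 / 16) :
    1 - 4 * ε ≤ msq (saw ε hε hε') ∧ msq (saw ε hε hε') ≤ 1 := by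
  have hw := DEIJ.continuous_slopeWave hε hε'
  have hi : IntervalIntegrable (fun t => DEIJ.slopeWave ε t ^ 2) volume 0 1 := (hw.pow 2).intervalIntegrable 0 1
  have hI : ∫ t in (0 : ℝ)..1, (1 - DEIJ.slopeWave ε t ^ 2) = 1 - msq (saw ε hε hε') := by
    rw [intervalIntegral.integral_sub intervalIntegrable_const hi, intervalIntegral.integral_const, msq,
      deriv_saw]
    simp
  have h1 := DEIJ.intervalIntegral_one_sub_slopeWave_sq_le hε hε'
  have h2 : 0 ≤ ∫ t in (0 : ℝ)..1, (1 - DEIJ.slopeWave ε t ^ 2) :=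
    intervalIntegral.integral_nonneg zero_le_one fun t _ => (DEIJ.one_sub_slopeWave_sq_mem hε hε' t).1
  rw [hI] at h1 h2
  constructor <;> linarith

/-- The ladder ratio: with `g = T = S_ε`, `c = G = Θ = 1` the kill threshold is `2γ/(√3(2+γ))`, which is
at least `2(1−4ε)/(√3(3−4ε))`. [ours; elementary] -/
theorem ladder_ratio_le {ε : ℝ} (hε : 0 < ε) (hε' : ε ≤ 1 / 16) :
    2 * (1 - 4 * ε) / (Real.sqrt 3 * (3 - 4 * ε)) ≤
      2 * 1 * msq (saw ε hε hε') * msq (saw ε hε hε') /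
        (Real.sqrt ((1 : ℝ) ^ 2 * 1 ^ 2 + (1 + 1 ^ 2) * 1 ^ 2) *
          (msq (saw ε hε hε') * (1 + msq (saw ε hε hε')) + 1 ^ 2 * msq (saw ε hε hε'))) := by
  obtain ⟨hlo, hhi⟩ := msq_saw_bounds hε hε'
  obtain ⟨γ, hγ⟩ : ∃ γ, γ = msq (saw ε hε hε') := ⟨_, rfl⟩
  rw [← hγ] at hlo hhi ⊢
  have hγ0 : 0 < γ := by linarith
  have hs3 : 0 < Real.sqrt 3 := by positivity
  have e : Real.sqrt ((1 : ℝ) ^ 2 * 1 ^ 2 + (1 + 1 ^ 2) * 1 ^ 2) = Real.sqrt 3 := by norm_num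
  rw [e, show 2 * 1 * γ * γ / (Real.sqrt 3 * (γ * (1 + γ) + 1 ^ 2 * γ)) = 2 * γ / (Real.sqrt 3 * (2 + γ)) by
    field_simp; ring]
  rw [div_le_div_iff₀ (by nlinarith) (by positivity)]
  nlinarith [mul_pos hs3 hγ0, hs3]

/-- **Kills along the ladder**: `¬ StretchingSupBound C` for every `C < 2(1−4ε)/(√3(3−4ε))`,
`0 < ε ≤ 1/16`. Search for candidate a priori estimates; no regularity claim. [ours] -/
theorem not_stretchingSupBound_saw {ε : ℝ} (hε : 0 < ε) (hε' : ε ≤ 1 / 16) {C : ℝ}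
    (hC : C < 2 * (1 - 4 * ε) / (Real.sqrt 3 * (3 - 4 * ε))) :
    ¬ StretchingSupBound (d := Fin 3) C := by
  obtain ⟨hlo, _⟩ := msq_saw_bounds hε hε'
  have hγ0 : 0 < msq (saw ε hε hε') := by linarith
  exact not_stretchingSupBound_shear (saw ε hε hε') (saw ε hε hε') 1 (abs_deriv_saw_le hε hε')
    (abs_deriv_saw_le hε hε') one_pos hγ0 hγ0 (hC.trans_le (ladder_ratio_le hε hε'))

/-- The ladder thresholds tend to `2√3/9` as `ε → 0⁺`. [ours; elementary] -/
theorem tendsto_ladder :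
    Tendsto (fun ε : ℝ => 2 * (1 - 4 * ε) / (Real.sqrt 3 * (3 - 4 * ε))) (𝓝[>] 0)
      (𝓝 (2 * Real.sqrt 3 / 9)) := by
  have hs3 : 0 < Real.sqrt 3 := by positivity
  have h3 : Real.sqrt 3 * Real.sqrt 3 = 3 := Real.mul_self_sqrt (by norm_num)
  have hval : 2 * (1 - 4 * (0 : ℝ)) / (Real.sqrt 3 * (3 - 4 * 0)) = 2 * Real.sqrt 3 / 9 := by
    rw [div_eq_div_iff (by positivity) (by norm_num)]; nlinarith [h3]
  rw [← hval]
  refine Filter.Tendsto.mono_left ?_ nhdsWithin_le_nhds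
  have hcont : ContinuousAt (fun ε : ℝ => 2 * (1 - 4 * ε) / (Real.sqrt 3 * (3 - 4 * ε))) 0 := by
    refine ContinuousAt.div (by fun_prop) (by fun_prop) ?_
    norm_num
  exact hcont.tendsto

/-- **`2√3/9 ≤ C⋆`: the sharp static sup-stretching constant of K1-Q1 is at least `2√3/9 ≈ 0.3849`**
(composition fields with smoothed square-wave slopes). `2√3/9` is the pressureless composition CLASS constant
(`C_pl = 2√3/9` exactly, `StretchingClassConstShear.lean`), not the K1-Q1 window: the tree's record lower bound for
`C⋆` is larger (`WrapFinal.nested_le_stretchingSupConst`, laminate rungs). Search for candidate a priori estimates;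
no regularity claim. [ours] -/
theorem two_sqrt_three_div_nine_le_stretchingSupConst :
    2 * Real.sqrt 3 / 9 ≤ stretchingSupConst (d := Fin 3) := by
  refine le_of_tendsto tendsto_ladder ?_
  filter_upwards [Ioc_mem_nhdsGT (by norm_num : (0 : ℝ) < 1 / 16)] with ε hε
  exact le_of_forall_lt_imp_le_of_dense fun C hC =>
    le_stretchingSupConst (not_stretchingSupBound_saw hε.1 hε.2 hC)

end ShearComposition

end Summit.NavierStokesRegularity.FunctionalMining

end
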